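import Summits.HodgeConjecture.HodgeConjecture.Theorems.HodgeLocusCensusTwoLinearCyclesRank
import HarnessLib

/-!
# HodgeLocusCensusExcessGrid — row G of the census (the EXCESS GRID) as ONE theorem for every standard pair
# `(n, d, m)` and every `λ = v/u ≠ 0` (cell pub-hlocus, lead gen 8)
HONEST FRAMING: certified instances and evidence bearing on the general Hodge conjecture; no claim.

Row G of `CENSUS-SUMMARY.md` §2 recorded, as an OBSERVED PATTERN over 51 computed cells, the first-order excess
`e(n,d,m) := intdim^d_n(m) − rank [p_{i+j}(u[ℙ] + v[ℙ̌])]` at the Fermat standard pair `ℙ = standardP n`,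
`ℙ̌ = standardPc n m t` (`ℙ ∩ ℙ̌ = ℙ^m`, `c := n/2 − m`, `k := n/2`):
`e = C(k,2)` (`c = 1`, `d = 3`), `C(k+1,2)` (`c = 1`, `d ≥ 4`), `k − 1` (`(c,d) = (2,3)`), `1` (`(c−1)(d−2) = 2`), `0` otherwise
— `gridExcess c d k` below. This file makes row G a THEOREM for all `(n, d, m)` (`n` even, `n + 2 ≤ (n/2)d`, `m < n/2`,
`t ≢ 0 mod d`) and all `u, v ∈ ℚ^×`, over every characteristic-zero field with a primitive `2d`-th root of unity:
`ivhsRank_standardPair_grid : (rank (ivhsMatrix n d ζ [(u, ℙ), (v, ℙ̌)]) : ℤ) = intdim n d (m+1) − gridExcess (n/2 − m) d (n/2)`.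
It is the census-side reading of the Literature theorem `Villaflor2022.rank_periodMatrix_two_linearCycles_int`
(Villaflor, manuscripta math. 167 (2022) Thm. 3 / Remark 7; Movasati–Villaflor 2018 Prop. 1, Thm. 2; Movasati 2016 Thm. 13;
lit-g16, p226482/p227360) — rank `= intdim −` the exact excess `#{β ∈ [0,d−2]^{m+1} : |β| = (n/2)d − n − 2}` — combined with the
closed form of that bounded-composition count (`excess_closed_form`, Gorenstein symmetry of the box `[0,d−2]^{m+1}` about
`(m+1)(d−2)/2` + the values `ciH_c(0) = 1`, `ciH_c(1) = c`, `ciH_c(2) = C(c+1,2)`, `ciH_c(socle) = 1`, `0` above the socle).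
Named Literature instances of the same law: `Villaflor2022.rank_two_linearCycles_cubic_codimTwo/_codimThree/_quartic_codimTwo`
(Kloosterman, Prop. 4.1 bounds attained) and Movasati's cubic Table 1. Consequences: the threshold
`rank = intdim ⟺ 2 < (n/2 − m − 1)(d − 2)` in census language (`ivhsRank_standardPair_eq_intdim_iff`), and instance rows,
e.g. `(8,4,2)`: `84 − 1 = 83` for `[ℙ] + [ℙ̌]` (the quartic two-plane row that gen 7 left as an optional certificate).
Two-block pairs (different pairings `b`) are NOT covered (same-pairing hypothesis of the Literature theorem).
-/

namespace Summit.HodgeConjecture.HodgeConjecture.HodgeLocus.Census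

open Literature.AlgebraicGeometry
open Literature.AlgebraicGeometry.Kloosterman2023 (ciHilbert ciHilbert_cons ciHilbert_nil intdim linC)
open Literature.AlgebraicGeometry.DuqueFrancoVillaflor2025 (conv conv_eq_sum_range ciHilbert_cons_eq_conv
  ciHilbert_singleton)

/-! ## The grid -/

/-- The census excess law (row G of CENSUS-SUMMARY §2) in closed form: the first-order excess
`codim (T_ℙ ∩ T_ℙ̌) − rank M_δ` at the Fermat standard pair, as a function of `c = n/2 − m` (the codimension of
`ℙ ∩ ℙ̌ = ℙ^m` in `ℙ^{n/2}`), the degree `d` and `k = n/2`. -/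
def gridExcess (c d k : ℕ) : ℕ :=
  if c = 1 then (if d = 3 then k.choose 2 else (k + 1).choose 2)
  else if (c - 1) * (d - 2) = 1 then k - 1
  else if (c - 1) * (d - 2) = 2 then 1
  else 0

/-- `c = 1`, `d = 3`: the excess is `C(k,2)`. -/
theorem gridExcess_one_three (k : ℕ) : gridExcess 1 3 k = k.choose 2 := by simp [gridExcess]

/-- `c = 1`, `d ≠ 3` (so `d ≥ 4` in the census): the excess is `C(k+1,2)`. -/
theorem gridExcess_one_of_ne {d : ℕ} (hd : d ≠ 3) (k : ℕ) : gridExcess 1 d k = (k + 1).choose 2 := by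
  simp [gridExcess, hd]

/-- `(c−1)(d−2) = 1`, i.e. `(c,d) = (2,3)`: the excess is `k − 1`. -/
theorem gridExcess_of_eq_one {c d : ℕ} (hc : c ≠ 1) (h : (c - 1) * (d - 2) = 1) (k : ℕ) :
    gridExcess c d k = k - 1 := by
  simp [gridExcess, hc, h]

/-- `(c−1)(d−2) = 2`, i.e. `(c,d) ∈ {(2,4),(3,3)}`: the excess is `1`. -/
theorem gridExcess_of_eq_two {c d : ℕ} (hc : c ≠ 1) (h : (c - 1) * (d - 2) = 2) (k : ℕ) :
    gridExcess c d k = 1 := by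
  simp [gridExcess, hc, h]

/-- `(c−1)(d−2) > 2`: no excess. -/
theorem gridExcess_of_two_lt {c d : ℕ} (hc : c ≠ 1) (h : 2 < (c - 1) * (d - 2)) (k : ℕ) :
    gridExcess c d k = 0 := by
  have h1 : (c - 1) * (d - 2) ≠ 1 := by omega
  have h2 : (c - 1) * (d - 2) ≠ 2 := by omega
  simp [gridExcess, hc, h1, h2]

/-! ## `ciHilbert` of a constant list: symmetry, vanishing, small values -/

/-- a constant list as `List.ofFn` of a constant function (to use the `ciHilbert_ofFn_*` lemmas). -/
theorem replicate_eq_ofFn (c e : ℕ) : List.replicate c e = List.ofFn (fun _ : Fin c => e) :=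
  (List.ofFn_const c e).symm

/-- Gorenstein symmetry of the box `[0,e−1]^c` about `c(e−1)/2`: `ciH(t) = ciH(u)` for `t + u = c(e−1)`. -/
theorem ciHilbert_replicate_symm {c e t u : ℕ} (he : 1 ≤ e) (htu : t + u = c * (e - 1)) :
    ciHilbert (List.replicate c e) t = ciHilbert (List.replicate c e) u := by
  rw [replicate_eq_ofFn]
  exact HodgeTheory.ciHilbert_ofFn_symm (fun _ : Fin c => e) (fun _ => he) (by simp [htu])

/-- `ciH_{[0,e−1]^c}(t) > 0 ⟺ t ≤ c(e−1)` (the socle degree). -/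
theorem ciHilbert_replicate_pos_iff {c e t : ℕ} (he : 1 ≤ e) :
    0 < ciHilbert (List.replicate c e) t ↔ t ≤ c * (e - 1) := by
  rw [replicate_eq_ofFn, HodgeTheory.ciHilbert_ofFn_pos_iff (fun _ : Fin c => e) (fun _ => he)]
  simp

/-- vanishing above the socle degree `c(e−1)`. -/
theorem ciHilbert_replicate_eq_zero {c e t : ℕ} (he : 1 ≤ e) (ht : c * (e - 1) < t) :
    ciHilbert (List.replicate c e) t = 0 := by
  by_contra h
  have := (ciHilbert_replicate_pos_iff (c := c) (t := t) he).mp (Nat.pos_of_ne_zero h)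
  omega

/-- the socle: exactly one `β ∈ [0,e−1]^c` with `|β| = c(e−1)`. -/
theorem ciHilbert_replicate_socle {c e : ℕ} (he : 1 ≤ e) :
    ciHilbert (List.replicate c e) (c * (e - 1)) = 1 := by
  rw [replicate_eq_ofFn]
  have h := HodgeTheory.ciHilbert_ofFn_socle (fun _ : Fin c => e) (fun _ => he)
  simp only [Finset.sum_const, Finset.card_univ, Fintype.card_fin, smul_eq_mul] at h
  exact h

/-- peeling one entry off a constant list, as a finite sum -/
theorem ciHilbert_replicate_succ_apply (c e k : ℕ) :
    ciHilbert (List.replicate (c + 1) e) k =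
      ∑ p ∈ Finset.range (k + 1), (if p < e then 1 else 0) * ciHilbert (List.replicate c e) (k - p) := by
  rw [List.replicate_succ, ciHilbert_cons_eq_conv, conv_eq_sum_range]
  simp only [ciHilbert_singleton]

/-- `ciH_{[0,e−1]^c}(0) = 1` (`e ≥ 1`). -/
theorem ciHilbert_replicate_at_zero (c e : ℕ) (he : 1 ≤ e) : ciHilbert (List.replicate c e) 0 = 1 := by
  induction c with
  | zero => simp [ciHilbert_nil]
  | succ c ih =>
    rw [ciHilbert_replicate_succ_apply, Finset.sum_range_one, ih]
    simp [show 0 < e from he]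

/-- `ciH_{[0,e−1]^c}(1) = c` (`e ≥ 2`). -/
theorem ciHilbert_replicate_at_one (c e : ℕ) (he : 2 ≤ e) : ciHilbert (List.replicate c e) 1 = c := by
  induction c with
  | zero => simp [ciHilbert_nil]
  | succ c ih =>
    rw [ciHilbert_replicate_succ_apply, Finset.sum_range_succ, Finset.sum_range_one, ih,
      ciHilbert_replicate_at_zero c e (by omega)]
    simp [show 0 < e by omega, show 1 < e by omega]

/-- `ciH_{[0,e−1]^c}(2) = C(c+1,2)` (`e ≥ 3`: all compositions of `2` into `c` parts `≤ 2` are allowed). -/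
theorem ciHilbert_replicate_at_two (c e : ℕ) (he : 3 ≤ e) :
    ciHilbert (List.replicate c e) 2 = (c + 1).choose 2 := by
  induction c with
  | zero => simp [ciHilbert_nil]
  | succ c ih =>
    rw [ciHilbert_replicate_succ_apply, Finset.sum_range_succ, Finset.sum_range_succ, Finset.sum_range_one, ih,
      ciHilbert_replicate_at_one c e (by omega), ciHilbert_replicate_at_zero c e (by omega)]
    simp only [show 0 < e by omega, show 1 < e by omega, show 2 < e by omega, if_true, one_mul]
    simp [Nat.choose_succ_succ, Nat.choose_one_right]
    ring

/-! ## The closed form of the census excess at the standard pair -/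

/-- **Row G as an identity of bounded-composition counts**: for `n` even, `n + 2 ≤ (n/2)d`, `m < n/2`,
`#{β ∈ [0,d−2]^{m+1} : |β| = (n/2)d − n − 2} = gridExcess (n/2 − m) d (n/2)`. -/
theorem excess_closed_form {n d m : ℕ} (hn : Even n) (hN : n + 2 ≤ n / 2 * d) (hm : m < n / 2) :
    ciHilbert (List.replicate (m + 1) (d - 1)) (n / 2 * d - n - 2) = gridExcess (n / 2 - m) d (n / 2) := by
  have hn2 : n % 2 = 0 := Nat.even_iff.mp hn
  have hd : 3 ≤ d := by
    by_contra h
    have : n / 2 * d ≤ n / 2 * 2 := Nat.mul_le_mul_left _ (by omega)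
    omega
  have hdeg := Villaflor2022.deg_add_rowDeg hn hN
  -- atoms: T = the row degree, X = socle degree of the common box, Y = (c-1)(d-2)
  set T := n / 2 * d - n - 2 with hT
  have hsplit : (n / 2 + 1) * (d - 2) = (m + 1) * (d - 2) + (n / 2 - m - 1) * (d - 2) + (d - 2) := by
    have : n / 2 + 1 = (m + 1) + (n / 2 - m - 1) + 1 := by omega
    rw [this, add_mul, add_mul, one_mul]
  have hX : (m + 1) * (d - 1 - 1) = (m + 1) * (d - 2) := by rw [show d - 1 - 1 = d - 2 by omega]
  by_cases hc1 : n / 2 - m = 1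
  · -- c = 1: the two cycles span a complete intersection; excess ciH_k(2)
    have hm1 : m + 1 = n / 2 := by omega
    have hzero : (n / 2 - m - 1) * (d - 2) = 0 := by rw [show n / 2 - m - 1 = 0 by omega, zero_mul]
    rw [hc1]
    by_cases hd3 : d = 3
    · subst hd3
      rw [gridExcess_one_three, show (3 : ℕ) - 1 = 2 from rfl, Movasati2016.ciHilbert_replicate_two, hm1]
      rw [show T = n / 2 - 2 by omega]
      exact Nat.choose_symm (by omega)
    · rw [gridExcess_one_of_ne hd3,
        ciHilbert_replicate_symm (u := 2) (by omega) (by rw [hX]; omega), hm1]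
      exact ciHilbert_replicate_at_two (n / 2) (d - 1) (by omega)
  · -- c ≥ 2
    have hc2 : 2 ≤ n / 2 - m := by omega
    have hYpos : d - 2 ≤ (n / 2 - m - 1) * (d - 2) := Nat.le_mul_of_pos_left _ (by omega)
    by_cases hY1 : (n / 2 - m - 1) * (d - 2) = 1
    · -- (c,d) = (2,3): excess ciH_{m+1}(1) = m + 1 = k - 1
      have hd3 : d = 3 := by omega
      have hcm : n / 2 - m - 1 = 1 := by
        have h' : (n / 2 - m - 1) * (d - 2) = (n / 2 - m - 1) * 1 := by rw [show d - 2 = 1 by omega]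
        rw [mul_one] at h'
        omega
      rw [gridExcess_of_eq_one hc1 hY1,
        ciHilbert_replicate_symm (u := 1) (by omega) (by rw [hX]; omega),
        ciHilbert_replicate_at_one (m + 1) (d - 1) (by omega)]
      omega
    by_cases hY2 : (n / 2 - m - 1) * (d - 2) = 2
    · -- (c−1)(d−2) = 2: the row degree is the socle degree of the box; excess 1
      rw [gridExcess_of_eq_two hc1 hY2, show T = (m + 1) * (d - 1 - 1) by rw [hX]; omega]
      exact ciHilbert_replicate_socle (by omega)
    · -- (c−1)(d−2) > 2: the row degree is above the socle; excess 0
      have hY3 : 2 < (n / 2 - m - 1) * (d - 2) := by omega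
      rw [gridExcess_of_two_lt hc1 hY3]
      exact ciHilbert_replicate_eq_zero (by omega) (by rw [hX]; omega)


/-- Positivity of the grid under the census hypotheses: `0 < gridExcess (n/2 − m) d (n/2) ⟺ (n/2 − m − 1)(d − 2) ≤ 2`
(the complement of Villaflor's threshold). -/
theorem gridExcess_pos_iff {n d m : ℕ} (hN : n + 2 ≤ n / 2 * d) (hm : m < n / 2) :
    0 < gridExcess (n / 2 - m) d (n / 2) ↔ (n / 2 - m - 1) * (d - 2) ≤ 2 := by
  have hd : 3 ≤ d := by
    by_contra h
    have : n / 2 * d ≤ n / 2 * 2 := Nat.mul_le_mul_left _ (by omega)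
    omega
  by_cases hc1 : n / 2 - m = 1
  · rw [hc1, show (1 : ℕ) - 1 = 0 from rfl, zero_mul]
    refine ⟨fun _ => by omega, fun _ => ?_⟩
    by_cases hd3 : d = 3
    · subst hd3
      rw [gridExcess_one_three]
      exact Nat.choose_pos (by omega)
    · rw [gridExcess_one_of_ne hd3]
      exact Nat.choose_pos (by omega)
  · have hYpos : d - 2 ≤ (n / 2 - m - 1) * (d - 2) := Nat.le_mul_of_pos_left _ (by omega)
    by_cases hY1 : (n / 2 - m - 1) * (d - 2) = 1
    · rw [gridExcess_of_eq_one hc1 hY1]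
      exact ⟨fun _ => by omega, fun _ => by omega⟩
    by_cases hY2 : (n / 2 - m - 1) * (d - 2) = 2
    · rw [gridExcess_of_eq_two hc1 hY2]
      exact ⟨fun _ => by omega, fun _ => by omega⟩
    · rw [gridExcess_of_two_lt hc1 (by omega)]
      exact ⟨fun h => absurd h (lt_irrefl 0), fun h => by omega⟩

/-! ## Census consequences: row G as a theorem -/

/-- The census matrix of `u·[P] + v·[P']` is Movasati's period matrix at MV18's combined period vector. -/
private theorem ivhsMatrix_pair' {K : Type*} [Field K] (n d : ℕ) (ζ : K) (u v : ℚ) (P P' : LinearCycle n) :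
    ivhsMatrix n d ζ [(u, P), (v, P')] = Movasati2016.periodMatrix (n+2) d (n/2*d-n-2) d
      (MovasatiVillaflor2018.combPeriod n d ζ [((u : K), P.a, P.b), ((v : K), P'.a, P'.b)]) := by
  rw [ivhsMatrix_eq_periodMatrix]
  rfl

/-- **The census rank of two same-pairing linear cycles, integer form**: for `n` even, `n + 2 ≤ (n/2)d`, `u, v ≠ 0`,
`c := commonCount n d a a' < n/2 + 1`, over any characteristic-zero field with a primitive `2d`-th root of unity `ζ`:
`rank (ivhsMatrix n d ζ [(u,⟨a,b⟩),(v,⟨a',b⟩)]) = intdim n d c − #{β ∈ [0,d−2]^c : |β| = (n/2)d − n − 2}`. -/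
theorem ivhsRank_two_linearCycles_int {n d : ℕ} (hn : Even n) (hN : n + 2 ≤ n / 2 * d)
    (b : Equiv.Perm (Fin (n+2))) (a a' : Fin (n+2) → ℕ) (hc : commonCount n d a a' < n / 2 + 1) {u v : ℚ}
    (hu : u ≠ 0) (hv : v ≠ 0) (K : Type*) [Field K] [CharZero K] (ζ : K) (hζ : IsPrimitiveRoot ζ (2 * d)) :
    ((ivhsMatrix n d ζ [(u, ⟨a, b⟩), (v, ⟨a', b⟩)]).rank : ℤ) =
      intdim n d (commonCount n d a a') -
        ciHilbert (List.replicate (commonCount n d a a') (d - 1)) (n / 2 * d - n - 2) := by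
  classical
  have hd0 : 2 * d ≠ 0 := fun h => by
    have hd : d = 0 := by omega
    subst hd
    simp at hN
  have hζ0 : ζ ≠ 0 := hζ.ne_zero hd0
  have hcard := card_commonPairs_eq (K := K) (n := n) (by omega) hζ a a'
  have hne : MovasatiVillaflor2018.twist n ζ a ≠ MovasatiVillaflor2018.twist n ζ a' := by
    intro h
    have hall : (Villaflor2022.commonPairs n ζ a a').card = n / 2 + 1 := by
      unfold Villaflor2022.commonPairs Villaflor2022.agreePairs
      rw [Finset.filter_true_of_mem fun e _ => congr_fun h e, Finset.card_univ, Fintype.card_fin]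
    omega
  rw [ivhsMatrix_pair']
  have h := Villaflor2022.rank_periodMatrix_two_linearCycles_int ζ a a' b hn hN hζ0 hne (u := (u : K))
    (v := (v : K)) (by exact_mod_cast hu) (by exact_mod_cast hv)
  rw [hcard] at h
  exact h

/-- The standard pair, integer form: `rank = intdim n d (m+1) − #{β ∈ [0,d−2]^{m+1} : |β| = (n/2)d − n − 2}`
(`m < n/2`, `t ≢ 0 mod d`, `u, v ≠ 0`). -/
theorem ivhsRank_standardPair_int {n d m t : ℕ} (hn : Even n) (hN : n + 2 ≤ n / 2 * d) (hm : m < n / 2)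
    (ht : t % d ≠ 0) {u v : ℚ} (hu : u ≠ 0) (hv : v ≠ 0) (K : Type*) [Field K] [CharZero K] (ζ : K)
    (hζ : IsPrimitiveRoot ζ (2 * d)) :
    ((ivhsMatrix n d ζ [(u, standardP n), (v, standardPc n m t)]).rank : ℤ) =
      intdim n d (m + 1) - ciHilbert (List.replicate (m + 1) (d - 1)) (n / 2 * d - n - 2) := by
  have h := ivhsRank_two_linearCycles_int hn hN 1 (standardP n).a (standardPc n m t).a
    (by rw [commonCount_standardPair hm.le ht]; omega) hu hv K ζ hζ
  rw [commonCount_standardPair hm.le ht] at h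
  exact h

/-- **ROW G (the excess grid) for every standard pair `(n, d, m)` and every `λ = v/u ≠ 0`**:
`rank (ivhsMatrix n d ζ [(u, ℙ), (v, ℙ̌)]) = intdim n d (m+1) − gridExcess (n/2 − m) d (n/2)` over every
characteristic-zero field with a primitive `2d`-th root of unity (`n` even, `n + 2 ≤ (n/2)d`, `m < n/2`, `t ≢ 0 mod d`). -/
theorem ivhsRank_standardPair_grid {n d m t : ℕ} (hn : Even n) (hN : n + 2 ≤ n / 2 * d) (hm : m < n / 2)
    (ht : t % d ≠ 0) {u v : ℚ} (hu : u ≠ 0) (hv : v ≠ 0) (K : Type*) [Field K] [CharZero K] (ζ : K)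
    (hζ : IsPrimitiveRoot ζ (2 * d)) :
    ((ivhsMatrix n d ζ [(u, standardP n), (v, standardPc n m t)]).rank : ℤ) =
      intdim n d (m + 1) - gridExcess (n / 2 - m) d (n / 2) := by
  rw [ivhsRank_standardPair_int hn hN hm ht hu hv K ζ hζ, excess_closed_form hn hN hm]

/-- **Villaflor's threshold in census language**: the standard-pair row attains `intdim n d (m+1)` iff
`2 < (n/2 − m − 1)(d − 2)`; otherwise the rank is strictly smaller, by exactly `gridExcess`. -/
theorem ivhsRank_standardPair_eq_intdim_iff {n d m t : ℕ} (hn : Even n) (hN : n + 2 ≤ n / 2 * d) (hm : m < n / 2)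
    (ht : t % d ≠ 0) {u v : ℚ} (hu : u ≠ 0) (hv : v ≠ 0) (K : Type*) [Field K] [CharZero K] (ζ : K)
    (hζ : IsPrimitiveRoot ζ (2 * d)) :
    ((ivhsMatrix n d ζ [(u, standardP n), (v, standardPc n m t)]).rank : ℤ) = intdim n d (m + 1) ↔
      2 < (n / 2 - m - 1) * (d - 2) := by
  rw [ivhsRank_standardPair_grid hn hN hm ht hu hv K ζ hζ]
  have hg := gridExcess_pos_iff hN hm
  omega

/-! ## Instances (numbers of record, re-derived from the general theorem) -/

/-- Grid values of record: `(10,3,4)` [c=1]: `C(5,2) = 10`; `(6,4,2)` [c=1]: `C(4,2) = 6`; `(8,3,2)` [c=2]: `3`;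
`(8,4,2)` [c=2]: `1`; `(10,3,2)` [c=3]: `1`; `(10,4,2)` [c=3]: `0`; `(8,5,2)` [c=2]: `0`. -/
theorem gridExcess_values :
    gridExcess 1 3 5 = 10 ∧ gridExcess 1 4 3 = 6 ∧ gridExcess 2 3 4 = 3 ∧ gridExcess 2 4 4 = 1 ∧
    gridExcess 3 3 5 = 1 ∧ gridExcess 3 4 5 = 0 ∧ gridExcess 2 5 4 = 0 := by
  decide

/-- The quartic two-plane row `(8,4,2)`, `[ℙ] + [ℙ̌]`: rank `84 − 1 = 83` (`intdim 8 4 3 = 84`), for every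
characteristic-zero field with a primitive 8th root of unity. -/
theorem ivhsRank_8_4_2_sum (K : Type*) [Field K] [CharZero K] (ζ : K) (hζ : IsPrimitiveRoot ζ 8) :
    ((ivhsMatrix 8 4 ζ [(1, standardP 8), (1, standardPc 8 2 1)]).rank : ℤ) = 83 := by
  have h := ivhsRank_standardPair_grid (n := 8) (d := 4) (m := 2) (t := 1) (u := 1) (v := 1) ⟨4, rfl⟩
    (by norm_num) (by norm_num) (by decide) one_ne_zero one_ne_zero K ζ hζ
  rw [h]
  decide

/-- … and as census certificates: `IvhsRankEq 8 4 83` for `[ℙ] ± [ℙ̌]` at `(8,4,2)` (from lit-g16's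
`ivhsRankEq_standardPair`, `pairRank 8 4 3 = 83`). -/
theorem ivhsRankEq_8_4_2 :
    IvhsRankEq 8 4 83 [(1, standardP 8), (1, standardPc 8 2 1)] ∧
    IvhsRankEq 8 4 83 [(1, standardP 8), (-1, standardPc 8 2 1)] := by
  refine ⟨?_, ?_⟩
  · have h := ivhsRankEq_standardPair (n := 8) (d := 4) (m := 2) (t := 1) (u := 1) (v := 1) ⟨4, rfl⟩
      (by norm_num) (by norm_num) (by decide) one_ne_zero one_ne_zero
    rwa [show pairRank 8 4 (2 + 1) = 83 by decide] at h
  · have h := ivhsRankEq_standardPair (n := 8) (d := 4) (m := 2) (t := 1) (u := 1) (v := -1) ⟨4, rfl⟩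
      (by norm_num) (by norm_num) (by decide) one_ne_zero (by norm_num)
    rwa [show pairRank 8 4 (2 + 1) = 83 by decide] at h

/-- The cubic `c = 1` column (`m = n/2 − 1`, two `ℙ^{n/2}`'s through a common `ℙ^{n/2−1}`): excess `C(n/2, 2)`,
e.g. `(10,3,4)`: `intdim 10 3 5 − 10`. -/
theorem ivhsRank_10_3_4_sum (K : Type*) [Field K] [CharZero K] (ζ : K) (hζ : IsPrimitiveRoot ζ 6) :
    ((ivhsMatrix 10 3 ζ [(1, standardP 10), (1, standardPc 10 4 1)]).rank : ℤ) = intdim 10 3 5 - 10 := by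
  have h := ivhsRank_standardPair_grid (n := 10) (d := 3) (m := 4) (t := 1) (u := 1) (v := 1) ⟨5, rfl⟩
    (by norm_num) (by norm_num) (by decide) one_ne_zero one_ne_zero K ζ hζ
  rw [h]
  decide

end Summit.HodgeConjecture.HodgeConjecture.HodgeLocus.Census
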